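import Summits.ResolutionOfSingularities.ResolutionOfSingularities.Theorems.TameTwoStoreyLU2
import HarnessLib

/-!
# TameTwoStoreyLU5 — STEP D of the law `exists_stable_fixed_chart` (the jointly `T`-fixed monomial chart and the `G`-stable `T`-fixed regular model `S′[G₁, y]`)

One of the landing files of the g29 node «TameTwoStorey» of the ROOT/RESIDUAL decomposition cell `decomp-res` (lens 1,
window (W-α) WHOLE; files `TameTwoStoreyLU`, `…LU1B`, `…LU2` (landed), `…LU3`–`…LU8`); see the module docstring of
`Summits.ResolutionOfSingularities.ResolutionOfSingularities.Theorems.TameTwoStoreyLU` for the thesis, the cell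
`TameOverInertLUAbove k O` (in `…LU2`), the law `relLU_of_tameOverInertLUAbove : TameOverInertLUAbove k O →
RelLocalUniformization k K O` (in `…LU7`), the paper instances and the sources.  This file: STEP D only.
Imports: the landed `…TameTwoStoreyLU2` only.  Problem side, sorry-free, hypothesis-free; every heavy theorem carries
`set_option maxHeartbeats … in` BEFORE its docstring — keep it.
-/

noncomputable section

open IsLocalRing Polynomial IntermediateField Literature.AlgebraicGeometry.Resolution
open Summit.ResolutionOfSingularities.ResolutionOfSingularities.Theorems.TameQuotientLU
open Summit.ResolutionOfSingularities.ResolutionOfSingularities.Theorems.TameAbelianQuotientLU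
open Summit.ResolutionOfSingularities.ResolutionOfSingularities.Theorems.InertiaIsotypicStability
open Summit.ResolutionOfSingularities.ResolutionOfSingularities.Theorems.TameInertialLU
open Summit.ResolutionOfSingularities.ResolutionOfSingularities.Theorems.TameAbelianMonomialChart

namespace Summit.ResolutionOfSingularities.ResolutionOfSingularities.Theorems.TameTwoStoreyLU

universe u

section Law

variable (k : Type) [Field k] {K : Type} [Field K] [Algebra k K]

variable {k}

set_option maxHeartbeats 2000000 in
/-- **STEP D of the two-storey law — the jointly `T`-fixed MONOMIAL CHART on a semi-invariant regular system of
parameters and the `G`-STABLE, `T`-FIXED model `T₁ = ι(R)[G₁, y] ⊆ O′ ∩ K_T`, regular at the centre of `O′`.**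
Frame as in `exists_semiInvariant_regularParameters`; input: a regular system of parameters `u_j` of
`B = locAtCentre M O′` (`M = S′[t₀]` a `G`-stable model over the `G`-fixed universally catenary base `S′`,
residues of `O′` algebraic over `S′`) with `τ_i u_j = ζ^{s′ i j} u_j` and `g u_j = ε_{g,j} u_j`,
`ε_{g,j}^{±1} ∈ M ∩ K_T`.  The chart `y_l = ∏_j u_j^{n_{lj}}` over the joint `T`-invariants `A = B ∩ K′^T`
(`TameAbelianMonomialChart.exists_fixed_monomialChart_of_commuting_isRegularLocalRing`, with `A` universally
catenary by `exists_finset_closure_eq_inf_jointFixedSubring` / `locAtCentre_inf_jointFixedSubring_eq` /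
`isUniversallyCatenaryRing_locAtCentre_closure`) gives `T₁ = S′[G₁, y]`, `T`-fixed, inside `O′`, containing every
`T`-fixed element of `M` (so the separator), with `locAtCentre T₁ O′` regular
(`locAtCentre_closure_locAtCentre_union_eq`), and `G`-STABLE AS A SET because
`g y_l = (∏_j ε_{g,j}^{n_{lj}}) · y_l` with `ε^{±1} ∈ T₁` (`apply_prod_zpow_eq`, `zpow_mem_of_inv_mem`) — no
`G`-fixed parameter and no section `H → G` is used. [cite: CossartPiltant2008, Lemma 9.4]
[cite: CossartPiltant2019, Prop. 4.10] -/
theorem exists_stable_fixed_chart {K' : Type} [Field K'] [Algebra K K']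
    {O' : ValuationSubring K'} (hGO' : ∀ (g : K' ≃ₐ[K] K') (y : K'), y ∈ O' ↔ g y ∈ O')
    (hgv : ∀ (g : K' ≃ₐ[K] K') (y : K'), O'.valuation (g y) = O'.valuation y)
    {e : ℕ} (he : 0 < e) (hve : O'.valuation (e : K') = 1)
    (τ : ℕ → K' ≃+* K') (r : ℕ) (hτapp : ∀ i < r, ∃ g : K' ≃ₐ[K] K', ∀ z, τ i z = g z)
    (hτe : ∀ i < r, τ i ^ e = 1) (hcomm : ∀ i < r, ∀ i' < r, ∀ z : K', τ i (τ i' z) = τ i' (τ i z))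
    (hτres : ∀ i < r, ∀ y ∈ O', O'.valuation (τ i y - y) < 1)
    (hnormal : ∀ (g : K' ≃ₐ[K] K') (i : ℕ), i < r → ∃ i', i' < r ∧ ∀ y, τ i (g y) = g (τ i' y))
    {ζ : K'} (hζe : ζ ^ e = 1) (hτζ : ∀ i < r, τ i ζ = ζ)
    (hvη : ∀ j : ℕ, 0 < j → j < e → O'.valuation (ζ ^ j - 1) = 1)
    (KT : Subfield K') (hKT : ∀ z : K', z ∈ KT ↔ ∀ i < r, τ i z = z)
    (S' : Subring K') (hSuc : IsUniversallyCatenaryRing S')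
    (hGS' : ∀ (g : K' ≃ₐ[K] K'), ∀ s ∈ S', g s = s)
    (halg : ∀ w : O', ∃ q : Polynomial S', (∃ i, IsUnit (q.coeff i)) ∧
      O'.valuation (Polynomial.aeval (w : K') q) < 1)
    (t₀ : Finset K') {M : Subring K'} (hMcl : M = Subring.closure ((S' : Set K') ∪ (t₀ : Set K')))
    (hMO : M ≤ O'.toSubring) (hGM : ∀ (g : K' ≃ₐ[K] K'), ∀ y ∈ M, g y ∈ M) (hζM : ζ ∈ M)
    {xs : K'} (hxsKT : xs ∈ KT) (hxsM : xs ∈ M)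
    (hBreg : IsRegularLocalRing (locAtCentre M O'))
    {d : ℕ} (hBdim : ringKrullDim (locAtCentre M O') = (d : ℕ))
    (u : Fin d → locAtCentre M O') (huspan : Ideal.span (Set.range u) = maximalIdeal (locAtCentre M O'))
    (hu0 : ∀ j, ((u j : locAtCentre M O') : K') ≠ 0)
    (s' : ℕ → Fin d → ℕ) (hτu : ∀ i < r, ∀ j, τ i (u j) = ζ ^ s' i j * u j)
    (ε : (K' ≃ₐ[K] K') → Fin d → K') (hgu : ∀ (g : K' ≃ₐ[K] K') (j), g (u j) = ε g j * u j)
    (hεM : ∀ (g : K' ≃ₐ[K] K') (j), ε g j ∈ M ∧ (ε g j)⁻¹ ∈ M)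
    (hεKT' : ∀ (g : K' ≃ₐ[K] K') (j), ε g j ∈ KT ∧ (ε g j)⁻¹ ∈ KT) :
    ∃ tt : Finset K', Subring.closure ((S' : Set K') ∪ (tt : Set K')) ≤ O'.toSubring ∧
      Subring.closure ((S' : Set K') ∪ (tt : Set K')) ≤ KT.toSubring ∧
      xs ∈ Subring.closure ((S' : Set K') ∪ (tt : Set K')) ∧
      (∀ (g : K' ≃ₐ[K] K'), ∀ w ∈ Subring.closure ((S' : Set K') ∪ (tt : Set K')),
        g w ∈ Subring.closure ((S' : Set K') ∪ (tt : Set K'))) ∧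
      IsRegularLocalRing (locAtCentre (Subring.closure ((S' : Set K') ∪ (tt : Set K'))) O') := by
  classical
  have he0 : e ≠ 0 := he.ne'
  let B : Subring K' := locAtCentre M O'
  have hBdef : B = locAtCentre M O' := rfl
  haveI : IsRegularLocalRing B := hBreg
  have hBO : B ≤ O'.toSubring := locAtCentre_le hMO
  have hMB : M ≤ B := le_locAtCentre M O'
  have hdomB : ∀ b : B, b ∈ maximalIdeal B ↔ O'.valuation (b : K') < 1 :=
    mem_maximalIdeal_locAtCentre_iff hMO
  have hunitB : ∀ b : B, O'.valuation (b : K') = 1 → IsUnit b := by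
    intro b hb
    by_contra hnu
    have h1 : b ∈ maximalIdeal B := (IsLocalRing.mem_maximalIdeal b).mpr (mem_nonunits_iff.mpr hnu)
    exact absurd hb (ne_of_lt ((hdomB b).mp h1))
  have hgB : ∀ (g : K' ≃ₐ[K] K'), ∀ b ∈ B, g b ∈ B := by
    intro g b hb
    obtain ⟨y, hy, s, hs, hsv, rfl⟩ := mem_locAtCentre_iff.mp hb
    exact mem_locAtCentre_iff.mpr ⟨g y, hGM g y hy, g s, hGM g s hs, by rw [hgv]; exact hsv,
      map_div₀ g y s⟩
  have hτO' : ∀ i < r, ∀ x ∈ O', τ i x ∈ O' := by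
    intro i hi x hx
    obtain ⟨g, hg⟩ := hτapp i hi
    rw [hg x]
    exact (hGO' g x).mp hx
  have hτM : ∀ i < r, ∀ x ∈ M, τ i x ∈ M := by
    intro i hi x hx
    obtain ⟨g, hg⟩ := hτapp i hi
    rw [hg x]
    exact hGM g x hx
  have hτB : ∀ i < r, ∀ b ∈ B, τ i b ∈ B := by
    intro i hi b hb
    obtain ⟨g, hg⟩ := hτapp i hi
    rw [hg b]
    exact hgB g b hb
  have hτS' : ∀ i < r, ∀ s ∈ S', τ i s = s := by
    intro i hi s hs
    obtain ⟨g, hg⟩ := hτapp i hi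
    rw [hg]
    exact hGS' g s hs
  have hS'M : S' ≤ M := fun s hs => by
    rw [hMcl]
    exact Subring.subset_closure (Or.inl hs)
  have hS'B : S' ≤ B := hS'M.trans hMB
  have hS'KT : S' ≤ KT.toSubring := fun s hs => (hKT s).mpr fun i hi => hτS' i hi s hs
  have heuB : IsUnit ((e : B)) := hunitB _ (by push_cast; exact hve)
  have hζB : ζ ∈ B := hMB hζM
  have hζuB : ∀ j : ℕ, 0 < j → j < e → IsUnit ((⟨ζ, hζB⟩ : B) ^ j - 1) := fun j hj hje =>
    hunitB _ (by push_cast; exact hvη j hj hje)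
  have hresB : ∀ i < r, ∀ b ∈ B, O'.valuation (τ i b - b) < 1 := fun i hi b hb =>
    hτres i hi b (hBO hb)
  -- the semi-invariant parameters read in `K′`
  let uF : Fin d → K' := fun j => ((u j : B) : K')
  have huB : ∀ j, uF j ∈ B := fun j => (u j).2
  have huspanF : Ideal.span (Set.range fun j => (⟨uF j, huB j⟩ : B)) = maximalIdeal B := by
    have h1 : (fun j => (⟨uF j, huB j⟩ : B)) = u := funext fun j => Subtype.ext rfl
    rw [h1]
    exact huspan
  -- the ring of joint `T`-invariants `A = B ∩ K′^T` is universally catenary, residues algebraic over it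
  have hτMcl : ∀ i < r, ∀ x ∈ Subring.closure ((S' : Set K') ∪ (t₀ : Set K')),
      τ i x ∈ Subring.closure ((S' : Set K') ∪ (t₀ : Set K')) := by
    rw [← hMcl]
    exact hτM
  obtain ⟨G₁, hG₁fix, hG₁M, hT₁eq⟩ := exists_finset_closure_eq_inf_jointFixedSubring τ r he0 hτe hcomm S'
    hSuc.1 hτS' t₀ hτMcl
  have hAeqr := locAtCentre_inf_jointFixedSubring_eq τ r he0 hτe hcomm O' hτO'
    (Subring.closure ((S' : Set K') ∪ (t₀ : Set K'))) hτMcl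
  let A : Subring K' := B ⊓ jointFixedSubring τ r
  have hA : ∀ b, b ∈ A ↔ b ∈ B ∧ ∀ i < r, τ i b = b := fun b => by
    rw [Subring.mem_inf, mem_jointFixedSubring]
  have hT₁O' : Subring.closure ((S' : Set K') ∪ ↑G₁) ≤ O'.toSubring := by
    rw [← hT₁eq]
    intro x hx
    rw [← hMcl] at hx
    exact hMO hx.1
  have hAuc : IsUniversallyCatenaryRing A := by
    change IsUniversallyCatenaryRing ↥(B ⊓ jointFixedSubring τ r)
    rw [hBdef, hMcl, hAeqr, hT₁eq]
    exact isUniversallyCatenaryRing_locAtCentre_closure O' S' hSuc G₁ hT₁O'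
  have hS'A : S' ≤ A := fun s hs => (hA s).mpr ⟨hS'B hs, fun i hi => hτS' i hi s hs⟩
  have halgA : ∀ w : O', ∃ q : Polynomial A, (∃ i, IsUnit (q.coeff i)) ∧
      O'.valuation (Polynomial.aeval (w : K') q) < 1 := by
    intro w
    obtain ⟨q, ⟨i, hi⟩, hqw⟩ := halg w
    refine ⟨q.map (Subring.inclusion hS'A), ⟨i, ?_⟩, ?_⟩
    · rw [Polynomial.coeff_map]; exact hi.map _
    · rw [Polynomial.aeval_def, Polynomial.eval₂_map]
      rw [Polynomial.aeval_def] at hqw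
      exact hqw
  obtain ⟨nexp, hτy, hyO, hregY⟩ :=
    exists_fixed_monomialChart_of_commuting_isRegularLocalRing O' τ r he0 hτe hcomm B hBO hdomB hτB
      heuB ζ hζB hτζ hζe hζuB hresB hBdim uF huB hu0 huspanF s' hτu A hA hAuc halgA
  let y : Fin d → K' := fun l => ∏ j, uF j ^ nexp l j
  -- the `T`-fixed, `G`-stable model `T₁ = S'[G₁, y] ⊆ O′ ∩ K_T`, regular at the centre of `O′`
  let tt : Finset K' := G₁ ∪ Finset.univ.image y
  set T₁ : Subring K' := Subring.closure ((S' : Set K') ∪ (tt : Set K')) with hT₁def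
  have hset : ((tt : Finset K') : Set K') = (G₁ : Set K') ∪ Set.range y := by
    ext w
    simp only [tt, Finset.coe_union, Set.mem_union, Finset.mem_coe, Finset.mem_image, Finset.mem_univ,
      true_and, Set.mem_range]
  have hT₁reg : IsRegularLocalRing (locAtCentre T₁ O') := by
    have hkey : locAtCentre (Subring.closure ((A : Set K') ∪ Set.range y)) O' = locAtCentre T₁ O' := by
      change locAtCentre (Subring.closure ((↑(B ⊓ jointFixedSubring τ r) : Set K') ∪ Set.range y)) O' = _
      rw [hBdef, hMcl, hAeqr, hT₁eq, locAtCentre_closure_locAtCentre_union_eq O', closure_closure_union,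
        hT₁def, hset, Set.union_assoc]
    rw [← hkey]
    exact hregY
  have hS'T₁ : S' ≤ T₁ := fun w hw => Subring.subset_closure (Or.inl hw)
  have httT₁ : ∀ w ∈ tt, w ∈ T₁ := fun w hw => Subring.subset_closure (Or.inr (Finset.mem_coe.mpr hw))
  have hyT₁ : ∀ l, y l ∈ T₁ := fun l =>
    httT₁ _ (Finset.mem_union_right _ (Finset.mem_image.mpr ⟨l, Finset.mem_univ _, rfl⟩))
  have hG₁M' : ∀ w ∈ G₁, w ∈ M := fun w hw => by
    rw [hMcl]
    exact hG₁M w hw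
  have hT₁O : T₁ ≤ O'.toSubring := by
    refine Subring.closure_le.mpr (Set.union_subset (fun w hw => hBO (hS'B hw)) ?_)
    intro w hw
    rcases Finset.mem_union.mp (Finset.mem_coe.mp hw) with hw | hw
    · exact hMO (hG₁M' w hw)
    · obtain ⟨l, -, rfl⟩ := Finset.mem_image.mp hw
      exact hyO l
  have hG₁T₁ : Subring.closure ((S' : Set K') ∪ ↑G₁) ≤ T₁ :=
    Subring.closure_le.mpr (Set.union_subset (fun w hw => hS'T₁ hw)
      fun w hw => httT₁ w (Finset.mem_union_left _ (Finset.mem_coe.mp hw)))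
  have hMfixT₁ : ∀ w ∈ M, (∀ i < r, τ i w = w) → w ∈ T₁ := by
    intro w hw hfix
    rw [hMcl] at hw
    have h1 : w ∈ Subring.closure ((S' : Set K') ∪ (t₀ : Set K')) ⊓ jointFixedSubring τ r :=
      Subring.mem_inf.mpr ⟨hw, (mem_jointFixedSubring τ r w).mpr hfix⟩
    rw [hT₁eq] at h1
    exact hG₁T₁ h1
  have hT₁KT : T₁ ≤ KT.toSubring := by
    refine Subring.closure_le.mpr (Set.union_subset (fun w hw => hS'KT hw) ?_)
    intro w hw
    rcases Finset.mem_union.mp (Finset.mem_coe.mp hw) with hw | hw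
    · exact (hKT w).mpr fun i hi => hG₁fix i hi w hw
    · obtain ⟨l, -, rfl⟩ := Finset.mem_image.mp hw
      exact (hKT _).mpr fun i hi => hτy i hi l
  have hxT₁ : xs ∈ T₁ := hMfixT₁ xs hxsM fun i hi => (hKT xs).mp hxsKT i hi
  have hεT₁ : ∀ (g : K' ≃ₐ[K] K') (j), ε g j ∈ T₁ ∧ (ε g j)⁻¹ ∈ T₁ := fun g j =>
    ⟨hMfixT₁ _ (hεM g j).1 fun i hi => (hKT _).mp (hεKT' g j).1 i hi,
     hMfixT₁ _ (hεM g j).2 fun i hi => (hKT _).mp (hεKT' g j).2 i hi⟩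
  -- `T₁` is `G`-STABLE: `g y_l = (∏ ε^{n}) · y_l` with `ε^{±1} ∈ T₁` (no section `H → G` is used)
  have hGT₁ : ∀ (g : K' ≃ₐ[K] K'), ∀ w ∈ T₁, g w ∈ T₁ := by
    intro g w hw
    have hle : Subring.closure ((S' : Set K') ∪ (tt : Set K')) ≤ T₁.comap (g : K' ≃+* K').toRingHom := by
      refine Subring.closure_le.mpr ?_
      intro w' hw'
      show g w' ∈ T₁
      rcases hw' with hw' | hw'
      · rw [hGS' g w' hw']
        exact hS'T₁ hw'
      · rcases Finset.mem_union.mp (Finset.mem_coe.mp hw') with hw' | hw'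
        · refine hMfixT₁ _ (hGM g w' (hG₁M' w' hw')) fun i hi => ?_
          obtain ⟨i', hi', hc⟩ := hnormal g i hi
          rw [hc, hG₁fix i' hi' w' hw']
        · obtain ⟨l, -, rfl⟩ := Finset.mem_image.mp hw'
          have h1 : g (y l) = (∏ j, ε g j ^ nexp l j) * y l :=
            apply_prod_zpow_eq (g : K' ≃+* K') uF (ε g) (hgu g) (nexp l)
          rw [h1]
          exact T₁.mul_mem (prod_mem fun j _ => zpow_mem_of_inv_mem (hεT₁ g j).1 (hεT₁ g j).2 _)
            (hyT₁ l)
    have hw' : w ∈ Subring.closure ((S' : Set K') ∪ (tt : Set K')) := by rw [← hT₁def]; exact hw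
    exact Subring.mem_comap.mp (hle hw')
  exact ⟨tt, hT₁O, hT₁KT, hxT₁, hGT₁, hT₁reg⟩

end Law

end Summit.ResolutionOfSingularities.ResolutionOfSingularities.Theorems.TameTwoStoreyLU

end
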